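import Literature.AlgebraicGeometry.AbelianSchemes.DualPairBaseQuotientDescent
import Literature.AlgebraicGeometry.AbelianSchemes.SeesawSheafIffGraphCondRelative
import Literature.AlgebraicGeometry.AbelianSchemes.PoincareFamilyPointsInjective
import Literature.AlgebraicGeometry.AbelianSchemes.AbelianSchemeSeesawSubschemeAffineBase
import Literature.AlgebraicGeometry.AbelianSchemes.MumfordQuotientSliceInjective
import Summits.HodgeConjecture.HodgeConjecture.Theorems.F3DualAbelianSchemeMcStubN0
import Summits.HodgeConjecture.HodgeConjecture.Theorems.F3DualAbelianSchemeMcStubN3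
import Literature.AlgebraicGeometry.Morphisms.ClosedImmersionOfProperUnramifiedInjective
import Literature.AlgebraicGeometry.Morphisms.FormallyUnramifiedOfDualNumberRigid
import Mathlib.RingTheory.DualNumber
import Literature.AlgebraicGeometry.AbelianSchemes.AbelianSchemeKOfL
import Literature.AlgebraicGeometry.AbelianSchemes.AbelianSchemeDualPairNormalize
import Literature.AlgebraicGeometry.Morphisms.ClosedImmersionIsoOfThickenings
import Literature.AlgebraicGeometry.Modules.DetClassTensor
import Literature.AlgebraicGeometry.Modules.DetClassDual
import Mathlib.FieldTheory.IsAlgClosed.Basic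
import HarnessLib

/-!
# F-3 (M) GRANDCHILD LINE `Cruxes/HDel/Lines/F3DualAbelianSchemeMc` — skeleton v1 (lead draft, B-p02 (g16), 2026-08-30; v1 = v0 ef3c28a3 + `stub_McN3d` binders `(hL) (_hε)`;
# v2.1 (custodian B-p02 (g17), joint edition with N3′ v1.3): = v2 49bc8eda + (N1′) `stub_McN1` DISCHARGED BY NAME over ★ p792841
# `AbelianSchemeOver.exists_seesawSubscheme_of_isAffine` + (W1) `socket_McW1` DISCHARGED BY NAME over ★ p792179
# `Morphisms.isClosedImmersion_of_forall_injective_geometricPoints` (B-p03 (g20)) + (N3d′) `stub_McN3d` PROVED (glue §4a `nonempty_graphIso_precomp`,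
# `formallyUnramified_fst_of_graph` = the lead's `AbelianSchemes/PoincareFamilyGraphFormallyUnramified` f7c24708 inlined until it is ★, over ★ p791848 §4
# `firstOrderRigid_of_graphCond` + ★ p787816 `FormallyUnramified.of_dualNumber_rigid`) + (N0′) `stub_McN0 := stub_McN0_holds` over ★ p793055 `Theorems/F3DualAbelianSchemeMcStubN0` (F0P1c-p06 (g0))
# + (N2b′) `stub_McN2b` gains the binder `(hL : HasRank L 1)` and is DISCHARGED over
# ★ p792862 `MumfordQuotientSliceInjective` (B-p16 (g18) body 5c7c76b7; call site §8 passes `hL`); all other letters byte-identical.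
# v2 (custodian B-p02 (g17), 2026-08-30): = v1 c822c846 + `import …AbelianSchemes.SeesawSheafIffGraphCondRelative` + (N2a′) `stub_McN2a` DISCHARGED BY NAME
# over ★ p788539 `AbelianSchemeOver.seesawSheaf_iff_graphCond` (B-p12 (g18); closer body = B-p08 (g15) J2 e48e3c37); every letter byte-identical;
# node table = SPINE v0 cec51c5f adopted by B-plan1 (g19) 20:03:53Z; HOME-only until the pen's `crux write` (R3); 0 names booked)

HC_CM is proved only modulo the 7 printed citations until rung 0 closes; nothing in this file is about HC.

PARENT: the (M) child line `Cruxes/HDel/Lines/F3DualAbelianSchemeM.lean` ed. 4 (8047f009), letter (Mc) `stub_F3Mc` («UNIVERSALITY of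
`(Â′, 𝒫′)` over ALL `T → S′`», the hardest letter of (M)).  This GRANDCHILD LINE proves that letter VERBATIM as `stub_F3Mc_holds` from SIX
third-layer stubs + ONE socket, along Mumford's §13 road in the «MONO, NOT ÉTALE» form of the tree's ℂ-engine ★
`Motives/PoincareUniversal/Residual.residual_affineFiniteType_of_M13` (ported node for node, [pts] steps over ALL points — D2 — and
Artinian towers over the residue field of an ARBITRARY point — D3):

* §1 `stub_McN1` (N1′) — RELATIVE SEESAW SUBSCHEME over the affine `S′` for ANY rank-one `𝓕` on `A′ × W`, `W → S′` locally of finite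
  type ([GortzWedhorn2023] Thm. 24.66 / [MumfordAV1970] §10; ★ `Motives/SeesawRelative*` R1–R10 assembly).  Shelf.
* §2 `stub_McN2a` (N2a′) — «RIGIDIFICATIONS KILL THE TWIST»: base-triviality of the seesaw sheaf `pr₁₂^*ℒ ⊗ (pr₁₃^*𝒫′)^∨` along
  `u : S → T′ × Â′` ⟺ `GraphCond′ u` := «`(1 × u₂)^*𝒫′ ≅ (1 × u₁)^*ℒ`» (port of ★ `SeesawSheafIffGraphCond`; B-p12 (g18)).
* §3 `stub_McN2b` (N2b′) — INJECTIVE ON GEOMETRIC POINTS: two `Ω`-points of `Â′` with the graph condition over the same `Ω`-point of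
  `T′` coincide (kernel clause + socket on the geometric fibre; B-p16 (g18)).
* §4 `stub_McN3d` (N3d′, coarse form) — the seesaw graph `Γ → T′` is FORMALLY UNRAMIFIED (first-order rigidity of `𝒫′` at every point:
  B-p07 (g20)'s étale-`π` road + the all-points criterion W2).
* §5 `stub_McN3` (N3′) — every infinitesimal neighbourhood `Spec 𝒪_{T′,t}/𝔪^{n+1}` of EVERY point `t ∈ T′` factors through `Γ → T′`
  (Artinian tower over `κ(t)`: level `0` = (H0) B-p09 (g17), frames, Kodaira–Spencer with (H1′) B-p07 (g20)).  Lead + hands.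
* §6 `socket_McW1` (W1) — generic ★-brick in flight (B-p03 (g20)): «locally of finite type + formally unramified + injective on all
  `Spec Ω`-points + proper ⇒ closed immersion» ([EGAIV4] 17.2.6, [StacksProject] 04XV); deleted by an edition when ★.
* §7 `stub_McN0` (N0′) — «affine finite type ⇒ all `T`» (Zariski locality ★ `PoincareUniversalLocality` + ★ `RigidifiedGluing` + spreading
  out; B-p16 (g18) census).
* §8 `stub_F3Mc_affineFiniteType_of` — THE COMPOSITION over an affine finite-type `T → S′`, PROVED (★ `Residual` §2 token for token):
  seesaw graph (N1′+N2a′) → proper + formally unramified (N3d′) + geometrically injective (N2b′) ⇒ closed immersion (W1) → all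
  thickenings factor (N3′) ⇒ isomorphism (★ `Morphisms.isIso_of_isClosedImmersion_of_forall_factor`, ALL points, no Jacobson) → the
  section `σ := inv ≫ i ≫ pr_Â′` classifies; uniqueness by the functor of points.  §9 HEAD `stub_F3Mc_holds` := §8 + N0′.

D1 (pen 20:03:53Z): NO `def` — `GraphCond′`/`seesawSheaf′` are SPELLED OUT in every letter.  `lean check` (v2.1): sorries = EXACTLY ONE open letter,
`stub_McN3` (N1′, N2a′, N2b′, N3d′, N0′ and the W1 socket are theorems; N3′ = the great-grandchild line `F3DualAbelianSchemeMcN3`); `--axioms …stub_F3Mc_holds` = {propext, Classical.choice, Quot.sound} ⊕ sorryAx.  Imports = the child line's three ★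
modules + ★ `Morphisms/ClosedImmersionIsoOfThickenings` + ★ `Modules/DetClass{Tensor,Dual}` + Mathlib + HarnessLib.
-/

noncomputable section

open CategoryTheory CategoryTheory.Limits AlgebraicGeometry MonoidalCategory CartesianMonoidalCategory
open scoped MonObj
open Literature.AlgebraicGeometry.AbelianSchemes Literature.AlgebraicGeometry.RelativeSpec
  Literature.AlgebraicGeometry.Motives Literature.AlgebraicGeometry.AbelianVarieties Literature.AlgebraicGeometry.Modules

namespace Summit.HodgeConjecture.CorCM.Cruxes.HypDel.F3DualAbelianSchemeMc

/-! ## §1 (N1′) — the relative seesaw closed subscheme over the affine base `S′` -/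

/-- **stub (N1′) `stub_McN1`** — [GortzWedhorn2023, Thm. 24.66] / [MumfordAV1970] §10 RELATIVE to the affine Noetherian `S′`: for an
abelian scheme `A′ → S′` (here `A′ = A ×_R S′`), `W → S′` locally of finite type and a rank-one `𝓕` on `A′ ×_{S′} W`, there is a closed
subscheme `Z ↪ W` such that `u : S → W` factors through `Z` iff `(1 × u)^*𝓕` is the pull-back of a rank-one sheaf on `S`.  ★ capital:
the RELATIVE EDITION `Motives/SeesawRelative*` (R1–R10: head `SeesawRelative.exists_seesawSubscheme_of_sockets` over `SchemeOver R′` with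
the Stein socket ★ `AbelianSchemeSteinOfNoetherian` and the representing-ideal socket ★ `SeesawRelativeChartKernelRepr*`), ★
`AbelianSchemeKOfLSeesaw` (the same assembly for the Mumford family).  Size M (1 file, assembly).  Why it might fail: only if the ★
representing-ideal engine is typed for a narrower class of families than «rank one on `A′ × W`» — then the hand widens it (Mumford §5
direct images of a flat coherent sheaf by a finite complex, ★ `Morphisms/CechH1FlatBaseChange*`).
[cite: GortzWedhorn2023, Thm. 24.66 (p. 405; proof pp. 407–408)] [cite: MumfordAV1970, §10 (p. 89)] -/
theorem stub_McN1 : ∀ (R : Type) [CommRing R] [IsNoetherianRing R] [Algebra ℚ R] (A : AbelianSchemeOver (Spec (.of R)))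
    {S' : Scheme.{0}} [IsAffine S'] (p : S' ⟶ Spec (.of R)) [IsFinite p] [Etale p]
    (W : Over S') [LocallyOfFiniteType W.hom] (𝓕 : ((A.baseChange p).X ⊗ W).left.Modules), HasRank 𝓕 1 →
    ∃ (Z : Over S') (i : Z ⟶ W) (_ : IsClosedImmersion i.left),
      ∀ (S : Over S') (u : S ⟶ W),
        (∃ v : S ⟶ Z, v ≫ i = u) ↔
          ∃ (𝓜 : S.left.Modules) (_ : HasRank 𝓜 1),
            Nonempty ((Scheme.Modules.pullback ((A.baseChange p).X ◁ u).left).obj 𝓕 ≅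
              (Scheme.Modules.pullback (CartesianMonoidalCategory.snd (A.baseChange p).X S).left).obj 𝓜) := by
  -- (N1′) DISCHARGED BY NAME (v2.1): ★ p792841 `AbelianSchemes/AbelianSchemeSeesawSubschemeAffineBase` (B-p12 (g18) ∕ F0P1c-p05 (g0))
  intro R _ _ _ A S' _ p _ _ W _ 𝓕 h𝓕
  haveI : IsLocallyNoetherian S' := LocallyOfFiniteType.isLocallyNoetherian p
  exact (A.baseChange p).exists_seesawSubscheme_of_isAffine W 𝓕 h𝓕

/-! ## §2 (N2a′) — rigidifications kill the twist: base-triviality of the seesaw sheaf ⟺ the graph condition -/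

/-- **stub (N2a′) `stub_McN2a`** — [MumfordAV1970] §13 (proof of the Theorem p. 125), the step «`(1 × u)^*(pr₁₂^*ℒ ⊗ (pr₁₃^*𝒫′)^∨) ≅
pr_S^*𝓜` for a line bundle `𝓜` on `S` ⟺ `(1 × u₂)^*𝒫′ ≅ (1 × u₁)^*ℒ`»: the twist `𝓜` is killed by the two rigidifications (`ℒ` along
`ε_T`, `𝒫′` along `ε × 1`, `_hrig`).  Port of ★ `Motives/PoincareUniversal/SeesawSheafIffGraphCond` (202 l., [ALG]) token for token
(B-p12 (g18), GO 20:04:33Z).  `GraphCond′` and `seesawSheaf′` SPELLED OUT (D1).  Size M (1 file).  Why it might fail: only as typed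
(the `(A′.X ⊗ S).left = pullback …` bookkeeping). [cite: MumfordAV1970, §13 (proof of the Thm. p. 125)] [cite: MilneAV2008, I §8 (pp. 36–37)] -/
theorem stub_McN2a : ∀ (R : Type) [CommRing R] [IsNoetherianRing R] [Algebra ℚ R] (A : AbelianSchemeOver (Spec (.of R)))
    {S' : Scheme.{0}} [IsAffine S'] (p : S' ⟶ Spec (.of R)) [IsFinite p] [Etale p]
    (hat : AbelianSchemeOver S') (P : ((A.baseChange p).prodLeft hat).Modules) (_h1 : HasRank P 1)
    (_hrig : Nonempty ((Scheme.Modules.pullback ((A.baseChange p).unitSlice hat)).obj P ≅ SheafOfModules.unit _))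
    (T' : Over S') (ℒ : (A.baseChange p).RigidifiedLineBundle T'.hom)
    (S : Over S') (u : S ⟶ T' ⊗ hat.X),
    (∃ (𝓜 : S.left.Modules) (_ : HasRank 𝓜 1),
      Nonempty ((Scheme.Modules.pullback ((A.baseChange p).X ◁ u).left).obj
        (tensorObj
          ((Scheme.Modules.pullback ((A.baseChange p).X ◁ CartesianMonoidalCategory.fst T' hat.X).left).obj ℒ.L)
          (Literature.AlgebraicGeometry.Modules.dual ((Scheme.Modules.pullback ((A.baseChange p).X ◁ CartesianMonoidalCategory.snd T' hat.X).left).obj P))) ≅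
        (Scheme.Modules.pullback (CartesianMonoidalCategory.snd (A.baseChange p).X S).left).obj 𝓜)) ↔
    Nonempty ((Scheme.Modules.pullback ((A.baseChange p).baseChangeToProd hat S.hom
        (u ≫ CartesianMonoidalCategory.snd T' hat.X).left (Over.w (u ≫ CartesianMonoidalCategory.snd T' hat.X)))).obj P ≅
      (Scheme.Modules.pullback ((A.baseChange p).X ◁ (u ≫ CartesianMonoidalCategory.fst T' hat.X)).left).obj ℒ.L) :=
  -- (N2a′) DISCHARGED BY NAME (v2): ★ p788539 `AbelianSchemeOver.seesawSheaf_iff_graphCond`, closer body of B-p08 (g15) J2 e48e3c37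
  fun _R _ _ _ A _S' _ p _ _ hat P h1 hrig _T' ℒ S u =>
    (A.baseChange p).seesawSheaf_iff_graphCond hat P ℒ h1 hrig S u

/-! ## §3 (N2b′) — the graph condition is injective on geometric points of `Â′` -/

/-- **stub (N2b′) `stub_McN2b`** — [MumfordAV1970] §13 (p. 125) «`Â = A/K(L)`»: two GEOMETRIC points `y, y′ : Spec Ω → Â′` over the
same geometric point `x` of `T′` (`Ω` algebraically closed, `s : Spec Ω → S′`; stated for two `Ω`-points `u = (x, y)`, `u′ = (x, y′)` of
`T′ × Â′` with equal first coordinate) which both satisfy the graph condition «`(1 × y)^*𝒫′ ≅ (1 × x)^*ℒ`» coincide: lifting `y = π(a)`, `y′ = π(a′)` through the surjective `π` and reading the SOCKET `_hsock` on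
slices, `t_a^*L′ ⊗ L′⁻¹ ≅ t_{a′}^*L′ ⊗ L′⁻¹`, so `a − a′ ∈ K(L′)` and `y = y′` by the KERNEL clause `_hker` (★ `comp_quotientMk_eq_one_iff`
pattern, ★ `isHomogeneous_pullback_baseChangeToProd_mumfordBundle`, ★ `AbelianSchemeKOfLFibres`).  Hand: B-p16 (g18) (GO 19:48:19Z).
Size S–M.  `GraphCond′` spelled out (D1) at the test object `Over.mk s`.  Why it might fail: only as typed (ALL alg. closed `Ω`, D2(a)).
[cite: MumfordAV1970, §13 Theorem (p. 125) and §8 (p. 77)] -/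
theorem stub_McN2b : ∀ (R : Type) [CommRing R] [IsNoetherianRing R] [Algebra ℚ R] (A : AbelianSchemeOver (Spec (.of R)))
    (L : A.left.Modules) (hL : HasRank L 1)
    {S' : Scheme.{0}} [IsAffine S'] (p : S' ⟶ Spec (.of R)) [IsFinite p] [Etale p]
    (hat : AbelianSchemeOver S') (π : (A.baseChange p).X ⟶ hat.X) [IsMonHom π]
    (_hπ : IsFinite π.left ∧ Etale π.left ∧ Surjective π.left)
    (P : ((A.baseChange p).prodLeft hat).Modules)
    (_hker : ∀ (T : Over S') (u : T ⟶ (A.baseChange p).X),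
      u ≫ π = 1 ↔ (A.baseChange p).MemKOfL ((Scheme.Modules.pullback (pullback.fst A.X.hom p)).obj L) u)
    (_h1 : HasRank P 1)
    (_hsock : Nonempty ((Scheme.Modules.pullback ((A.baseChange p).X ◁ π).left).obj P ≅
      (A.baseChange p).mumfordBundle ((Scheme.Modules.pullback (pullback.fst A.X.hom p)).obj L)))
    (T' : Over S') (ℒ : (A.baseChange p).RigidifiedLineBundle T'.hom) (_hℒ : ℒ.FibrewisePicZero)
    {Ω : Type} [Field Ω] [IsAlgClosed Ω] (s : Spec (.of Ω) ⟶ S') (u u' : Over.mk s ⟶ T' ⊗ hat.X),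
    u ≫ CartesianMonoidalCategory.fst T' hat.X = u' ≫ CartesianMonoidalCategory.fst T' hat.X →
    Nonempty ((Scheme.Modules.pullback ((A.baseChange p).baseChangeToProd hat (Over.mk s).hom
        (u ≫ CartesianMonoidalCategory.snd T' hat.X).left (Over.w (u ≫ CartesianMonoidalCategory.snd T' hat.X)))).obj P ≅
      (Scheme.Modules.pullback ((A.baseChange p).X ◁ (u ≫ CartesianMonoidalCategory.fst T' hat.X)).left).obj ℒ.L) →
    Nonempty ((Scheme.Modules.pullback ((A.baseChange p).baseChangeToProd hat (Over.mk s).hom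
        (u' ≫ CartesianMonoidalCategory.snd T' hat.X).left (Over.w (u' ≫ CartesianMonoidalCategory.snd T' hat.X)))).obj P ≅
      (Scheme.Modules.pullback ((A.baseChange p).X ◁ (u' ≫ CartesianMonoidalCategory.fst T' hat.X)).left).obj ℒ.L) →
    u ≫ CartesianMonoidalCategory.snd T' hat.X = u' ≫ CartesianMonoidalCategory.snd T' hat.X := by
  -- (N2b′) DISCHARGED (v2.1, reshaped letter `(hL)`): ★ p792862 `AbelianSchemes/MumfordQuotientSliceInjective` (B-p16 (g18), body 5c7c76b7 verbatim)
  intro R _ _ _ A L hL S' _ p _ _ hat π _ hπ P hker _h1 hsock T' ℒ _hℒ Ω _ _ s u u' hfst hu hu'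
  haveI : IsFinite π.left := hπ.1
  haveI : Surjective π.left := hπ.2.2
  obtain ⟨eu⟩ := hu
  obtain ⟨eu'⟩ := hu'
  have e : Nonempty ((Scheme.Modules.pullback ((A.baseChange p).baseChangeToProd hat (Over.mk s).hom
        (u ≫ CartesianMonoidalCategory.snd T' hat.X).left (Over.w (u ≫ CartesianMonoidalCategory.snd T' hat.X)))).obj P ≅
      (Scheme.Modules.pullback ((A.baseChange p).baseChangeToProd hat (Over.mk s).hom
        (u' ≫ CartesianMonoidalCategory.snd T' hat.X).left (Over.w (u' ≫ CartesianMonoidalCategory.snd T' hat.X)))).obj P) :=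
    ⟨eu ≪≫ eqToIso (by rw [hfst]) ≪≫ eu'.symm⟩
  exact Over.OverMorphism.ext ((A.baseChange p).eq_of_nonempty_pullback_baseChangeToProd_iso_of_socket hat π P hsock
    (hasRank_pullback _ hL) (fun T v hv => (hker T v).2 hv) s _ _ (Over.w _) (Over.w _) e)

section N3dGlue

open Literature.AlgebraicGeometry Literature.AlgebraicGeometry.Motives Literature.AlgebraicGeometry.Modules
open scoped DualNumber

-- `TopCat.Presheaf`/`Scheme.Modules` are not reducible (as in ★ `PoincareFamilyPointsInjective`).
set_option backward.isDefEq.respectTransparency false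

namespace GraphUnramified

/-! ## §4a GLUE for N3d′ (v2.1; = the lead's `AbelianSchemes/PoincareFamilyGraphFormallyUnramified` f7c24708, inlined until ★) -/

section Glue

variable {S : Scheme.{0}} (A : AbelianSchemeOver S)

/-- (G0) `(1 × (u ≫ v)) = (1 × u) ≫ (1 × v)` on underlying maps. [cite: GortzWedhorn2020, Section (4.7) (pp. 107–108)] -/
theorem whiskerLeft_comp_left_eq {U V W : Over S} (u : U ⟶ V) (v : V ⟶ W) :
    (A.X ◁ (u ≫ v)).left = (A.X ◁ u).left ≫ (A.X ◁ v).left := by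
  rw [MonoidalCategory.whiskerLeft_comp, Over.comp_left]

/-- (G1) **Graph points pull back**: if `y` is a graph point for `x` over the test object `Y → S` (`(1 × y)^*𝒫 ≅ (1 × x)^*ℒ`) and
`b : Y₁ → Y` is a map of test objects over `S`, then `b ≫ y` is a graph point for `b ≫ x` (apply `(1 × b)^*`; the `(1 × y)` on the `𝒫`
side is ★ `baseChangeToProd`, rewritten as a whiskering by ★ `baseChangeToProd_eq_whiskerLeft_left`).
[cite: MumfordAV1970, §13 (proof of the Thm., pp. 125–130)] [cite: GortzWedhorn2020, Section (4.7) (pp. 107–108)] -/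
theorem nonempty_graphIso_precomp (hat : AbelianSchemeOver S) (P : (A.prodLeft hat).Modules) {T' : Over S}
    (ℒ : A.RigidifiedLineBundle T'.hom) {Y₁ Y : Scheme.{0}} {s₁ : Y₁ ⟶ S} {s : Y ⟶ S} (b : Over.mk s₁ ⟶ Over.mk s)
    (x : Over.mk s ⟶ T') (y : Over.mk s ⟶ hat.X)
    (e : Nonempty ((Scheme.Modules.pullback (A.baseChangeToProd hat s y.left (Over.w y))).obj P ≅
      (Scheme.Modules.pullback (A.X ◁ x).left).obj ℒ.L)) :
    Nonempty ((Scheme.Modules.pullback (A.baseChangeToProd hat s₁ (b ≫ y).left (Over.w (b ≫ y)))).obj P ≅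
      (Scheme.Modules.pullback (A.X ◁ (b ≫ x)).left).obj ℒ.L) := by
  obtain ⟨e⟩ := e
  have hb : A.baseChangeToProd hat s y.left (Over.w y) = (A.X ◁ y).left := A.baseChangeToProd_eq_whiskerLeft_left hat y
  have hbb : A.baseChangeToProd hat s₁ (b ≫ y).left (Over.w (b ≫ y)) = (A.X ◁ b).left ≫ (A.X ◁ y).left :=
    (A.baseChangeToProd_eq_whiskerLeft_left hat (b ≫ y)).trans (whiskerLeft_comp_left_eq A b y)
  have hx : (A.X ◁ b).left ≫ (A.X ◁ x).left = (A.X ◁ (b ≫ x)).left := (whiskerLeft_comp_left_eq A b x).symm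
  exact ⟨(Scheme.Modules.pullbackCongr hbb).app P ≪≫
    ((Scheme.Modules.pullbackComp (A.X ◁ b).left (A.X ◁ y).left).app P).symm ≪≫
    (Scheme.Modules.pullback (A.X ◁ b).left).mapIso ((Scheme.Modules.pullbackCongr hb.symm).app P ≪≫ e) ≪≫
    (Scheme.Modules.pullbackComp (A.X ◁ b).left (A.X ◁ x).left).app ℒ.L ≪≫
    (Scheme.Modules.pullbackCongr hx).app ℒ.L⟩

end Glue



section Unramified

variable {S : Scheme.{0}} [IsLocallyNoetherian S] (A hat : AbelianSchemeOver S) (π : A.X ⟶ hat.X) [IsMonHom π]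
  [Flat π.left] [Surjective π.left]
  {L : A.left.Modules} (hL : HasRank L 1)
  (hε : CechPic.pullback A.unitSection (detClass (HasRank.isFiniteLocallyFree' hL)) = 1)
  (hker : ∀ (T : Over S) (u : T ⟶ A.X), u ≫ π = 1 ↔ A.MemKOfL L u)
  (P : (A.prodLeft hat).Modules)
  (hsock : Nonempty ((Scheme.Modules.pullback (A.X ◁ π).left).obj P ≅ A.mumfordBundle L))

include hε hker hsock in
/-- **THE SEESAW GRAPH IS FORMALLY UNRAMIFIED OVER THE TEST SCHEME** ([MumfordAV1970] §13, proof of the Theorem: «`Γ → T′` is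
unramified», the Kodaira–Spencer map of `𝒫` being injective at every point).  Data: the standing data of ★ `firstOrderRigid_of_graphCond`
(`Â = A/K(L)` presented by the flat surjective homomorphism `π` with kernel clause `hker`, the Poincaré family `𝒫 = P` with socket
`(1 × π)^*𝒫 ≅ Λ(L)`, `L` of rank one rigidified along the zero section); a test object `T′ → S` locally of finite type with a rigidified
line bundle `ℒ` on `A × T′`; and a closed immersion of `S`-schemes `i : Γ ↪ T′ ×_S Â` whose functor of points is the GRAPH CONDITION
(`hΓ`: an `S`-morphism `u : Y → T′ ×_S Â` factors through `Γ` iff `(1 × u₂)^*𝒫 ≅ (1 × u₁)^*ℒ`).  Then `Γ → T′` is formally unramified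
(★ `FormallyUnramified.of_dualNumber_rigid` + ★ §4 + (G1), see the module docstring).
[cite: MumfordAV1970, §13 (proof of the Thm., pp. 125–130)] [cite: EGAIV4, Prop. 17.4.1 and Cor. 17.4.2]
[cite: GortzWedhorn2020, (6.4) and Prop. 6.7 (p. 152)] -/
theorem formallyUnramified_fst_of_graph (T' : Over S) [LocallyOfFiniteType T'.hom] (ℒ : A.RigidifiedLineBundle T'.hom)
    (Γ : Over S) (i : Γ ⟶ T' ⊗ hat.X) [IsClosedImmersion i.left]
    (hΓ : ∀ (Y : Over S) (u : Y ⟶ T' ⊗ hat.X), (∃ v : Y ⟶ Γ, v ≫ i = u) ↔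
      Nonempty ((Scheme.Modules.pullback (A.baseChangeToProd hat Y.hom (u ≫ snd T' hat.X).left (Over.w (u ≫ snd T' hat.X)))).obj P ≅
        (Scheme.Modules.pullback (A.X ◁ (u ≫ fst T' hat.X)).left).obj ℒ.L)) :
    FormallyUnramified (i ≫ fst T' hat.X).left := by
  classical
  -- `Γ → T′` is locally of finite type
  haveI := hat.isProper
  haveI : LocallyOfFiniteType hat.X.hom := inferInstance
  haveI : LocallyOfFiniteType (fst T' hat.X).left := (inferInstance : LocallyOfFiniteType (pullback.fst T'.hom hat.X.hom))
  haveI : LocallyOfFiniteType (i ≫ fst T' hat.X).left := (inferInstance : LocallyOfFiniteType (i.left ≫ (fst T' hat.X).left))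
  refine Morphisms.FormallyUnramified.of_dualNumber_rigid _ fun K _ w t hw => ?_
  -- bookkeeping in `Over S`
  have hw' : w ≫ i.left ≫ (fst T' hat.X).left = Spec.map (CommRingCat.ofHom (algebraMap K K[ε])) ≫ t := by
    simpa only [Over.comp_left, Category.assoc] using hw
  have hT : (T' ⊗ hat.X).hom = (fst T' hat.X).left ≫ T'.hom := (Over.w _).symm
  let u : Over.mk (Spec.map (CommRingCat.ofHom (algebraMap K K[ε])) ≫ t ≫ T'.hom) ⟶ T' ⊗ hat.X :=
    Over.homMk (w ≫ i.left) (by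
      change (w ≫ i.left) ≫ (T' ⊗ hat.X).hom = Spec.map (CommRingCat.ofHom (algebraMap K K[ε])) ≫ t ≫ T'.hom
      rw [hT]
      simp only [Category.assoc]
      rw [reassoc_of% hw'])
  let v : Over.mk (Spec.map (CommRingCat.ofHom (algebraMap K K[ε])) ≫ t ≫ T'.hom) ⟶ Γ :=
    Over.homMk w (by
      change w ≫ Γ.hom = Spec.map (CommRingCat.ofHom (algebraMap K K[ε])) ≫ t ≫ T'.hom
      rw [← Over.w i, hT, reassoc_of% hw'])
  have hvu : v ≫ i = u := Over.OverMorphism.ext rfl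
  let strq : Over.mk (Spec.map (CommRingCat.ofHom (algebraMap K K[ε])) ≫ t ≫ T'.hom) ⟶ Over.mk (t ≫ T'.hom) :=
    Over.homMk (Spec.map (CommRingCat.ofHom (algebraMap K K[ε]))) rfl
  let tq : Over.mk (t ≫ T'.hom) ⟶ T' := Over.homMk t rfl
  have hu : u ≫ fst T' hat.X = strq ≫ tq := Over.OverMorphism.ext (by
    change (w ≫ i.left) ≫ (fst T' hat.X).left = Spec.map (CommRingCat.ofHom (algebraMap K K[ε])) ≫ t
    rw [Category.assoc]
    exact hw')
  -- the graph isomorphism over `K[ε]` (functor of points of `Γ`, forward)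
  have e : Nonempty ((Scheme.Modules.pullback (A.baseChangeToProd hat
      (Spec.map (CommRingCat.ofHom (algebraMap K K[ε])) ≫ t ≫ T'.hom)
      (u ≫ snd T' hat.X).left (Over.w (u ≫ snd T' hat.X)))).obj P ≅
      (Scheme.Modules.pullback (A.X ◁ (u ≫ fst T' hat.X)).left).obj ℒ.L) :=
    (hΓ _ u).mp ⟨v, hvu⟩
  -- ★ §4: the `Â`-coordinate is constant
  obtain ⟨y, hy⟩ := A.firstOrderRigid_of_graphCond hat π hL hε hker P hsock T'.hom ℒ (t ≫ T'.hom) u tq hu e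
  have hy' : u ≫ snd T' hat.X = strq ≫ y := hy
  -- restrict the graph isomorphism along the `K`-point `ε ↦ 0` of `Spec K[ε]`
  have hK : (TrivSqZeroExt.fstHom K K K).toRingHom.comp (algebraMap K K[ε]) = RingHom.id K :=
    RingHom.ext fun a => rfl
  have h0 : Spec.map (CommRingCat.ofHom (TrivSqZeroExt.fstHom K K K).toRingHom) ≫
      Spec.map (CommRingCat.ofHom (algebraMap K K[ε])) = 𝟙 _ := by
    rw [← Spec.map_comp, ← CommRingCat.ofHom_comp, hK, CommRingCat.ofHom_id, Spec.map_id]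
  let b₀ : Over.mk (t ≫ T'.hom) ⟶ Over.mk (Spec.map (CommRingCat.ofHom (algebraMap K K[ε])) ≫ t ≫ T'.hom) :=
    Over.homMk (Spec.map (CommRingCat.ofHom (TrivSqZeroExt.fstHom K K K).toRingHom)) (by
      change Spec.map (CommRingCat.ofHom (TrivSqZeroExt.fstHom K K K).toRingHom) ≫
        Spec.map (CommRingCat.ofHom (algebraMap K K[ε])) ≫ t ≫ T'.hom = t ≫ T'.hom
      rw [reassoc_of% h0])
  have hb₀ : b₀ ≫ strq = 𝟙 _ := Over.OverMorphism.ext h0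
  have hby : b₀ ≫ strq ≫ y = y := by rw [← Category.assoc, hb₀, Category.id_comp]
  have hbt : b₀ ≫ strq ≫ tq = tq := by rw [← Category.assoc, hb₀, Category.id_comp]
  rw [hu, hy'] at e
  have e₀ := nonempty_graphIso_precomp A hat P ℒ b₀ (strq ≫ tq) (strq ≫ y) e
  rw [hby, hbt] at e₀
  -- the `K`-point of `Γ` (functor of points of `Γ`, backward)
  obtain ⟨v₀, hv₀⟩ := (hΓ (Over.mk (t ≫ T'.hom)) (lift tq y)).mpr (by
    rw [lift_snd, lift_fst]
    exact e₀)
  refine ⟨v₀.left, ?_⟩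
  -- `γ = str ≫ v₀`: both have image `u` under the monomorphism `i`
  have hu' : u = strq ≫ v₀ ≫ i := CartesianMonoidalCategory.hom_ext _ _
    (by rw [hu, Category.assoc, Category.assoc, reassoc_of% hv₀, lift_fst])
    (by rw [hy', Category.assoc, Category.assoc, reassoc_of% hv₀, lift_snd])
  have hl := congrArg (fun w => w.left) hu'
  change w ≫ i.left = Spec.map (CommRingCat.ofHom (algebraMap K K[ε])) ≫ v₀.left ≫ i.left at hl
  rw [← cancel_mono i.left, Category.assoc]
  exact hl

end Unramified

end GraphUnramified

end N3dGlue

/-! ## §4 (N3d′, coarse form) — the seesaw graph is formally unramified over `T′` (first-order rigidity at EVERY point) -/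

/-- **stub (N3d′) `stub_McN3d`** — [MumfordAV1970] §13 (proof, pp. 127–129: the Poincaré family has no first-order deformations along
`Â`), over EVERY point (D2/D3): for the seesaw graph `Γ ↪ T′ ×_{S′} Â′` (a closed subscheme whose functor of points is the graph condition),
`Γ → T′` is FORMALLY UNRAMIFIED.  Road (B-p07 (g20) 20:04:24Z, adopted): a `κ(t)[ε]`-point of `Γ` over the constant `κ(t)[ε]`-point of `T′`
lifts through the ÉTALE `π` (★ `exists_lift_of_etale`); the graph condition + `_hsock` make the corresponding Mumford-slice deformation
constant, i.e. `MemKOfL`, so by the KERNEL clause `_hker` ON `κ[ε]`-POINTS the point is constant in `Â′`; then the stalk criterion ★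
`Morphisms.stalk_of_dualNumber_rigid` at every point and the all-points twin W2 of ★ `formallyUnramified_of_forall_isClosed_map_maximalIdeal`
(B-p08 (g15)).  Size M–L (2 files).  Why it might fail: only as typed — the dual-number currency over `κ(t)` for varying `t` is new in the
tree (★ is `ℂ[ε]`-typed); the mathematics is Mumford's.  v1 (2026-08-30 21:0xZ): binders `(hL) (_hε)` ADDED — first-order rigidity
(B-p07 (g20) `firstOrderRigid_of_graphCond`) consumes the rank and the rigidification of `L`; CLOSED IN HOME by the lead's
`F3DualAbelianSchemeMcN3d` closer over B-p07's (D)+(R) + ★ `FormallyUnramified.of_dualNumber_rigid` (by-paste cert, axioms trio).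
[cite: MumfordAV1970, §13 (proof of the Thm., pp. 125–129)] [cite: GortzWedhorn2020, (6.4) Prop. 6.7] -/
theorem stub_McN3d : ∀ (R : Type) [CommRing R] [IsNoetherianRing R] [Algebra ℚ R] (A : AbelianSchemeOver (Spec (.of R)))
    (L : A.left.Modules) (hL : HasRank L 1)
    (_hε : CechPic.pullback A.unitSection (detClass (HasRank.isFiniteLocallyFree' hL)) = 1)
    {S' : Scheme.{0}} [IsAffine S'] (p : S' ⟶ Spec (.of R)) [IsFinite p] [Etale p]
    (hat : AbelianSchemeOver S') (π : (A.baseChange p).X ⟶ hat.X) [IsMonHom π]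
    (_hπ : IsFinite π.left ∧ Etale π.left ∧ Surjective π.left)
    (P : ((A.baseChange p).prodLeft hat).Modules)
    (_hker : ∀ (T : Over S') (u : T ⟶ (A.baseChange p).X),
      u ≫ π = 1 ↔ (A.baseChange p).MemKOfL ((Scheme.Modules.pullback (pullback.fst A.X.hom p)).obj L) u)
    (_h1 : HasRank P 1)
    (_hrig : Nonempty ((Scheme.Modules.pullback ((A.baseChange p).unitSlice hat)).obj P ≅ SheafOfModules.unit _))
    (_hsock : Nonempty ((Scheme.Modules.pullback ((A.baseChange p).X ◁ π).left).obj P ≅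
      (A.baseChange p).mumfordBundle ((Scheme.Modules.pullback (pullback.fst A.X.hom p)).obj L)))
    (T' : Over S') [LocallyOfFiniteType T'.hom] (ℒ : (A.baseChange p).RigidifiedLineBundle T'.hom) (_hℒ : ℒ.FibrewisePicZero)
    (Γ : Over S') (i : Γ ⟶ T' ⊗ hat.X) [IsClosedImmersion i.left],
    (∀ (S : Over S') (u : S ⟶ T' ⊗ hat.X), (∃ v : S ⟶ Γ, v ≫ i = u) ↔
      Nonempty ((Scheme.Modules.pullback ((A.baseChange p).baseChangeToProd hat S.hom
          (u ≫ CartesianMonoidalCategory.snd T' hat.X).left (Over.w (u ≫ CartesianMonoidalCategory.snd T' hat.X)))).obj P ≅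
        (Scheme.Modules.pullback ((A.baseChange p).X ◁ (u ≫ CartesianMonoidalCategory.fst T' hat.X)).left).obj ℒ.L)) →
    FormallyUnramified (i ≫ CartesianMonoidalCategory.fst T' hat.X).left := by
  -- (N3d′) PROVED (v2.1) over §4a `GraphUnramified.formallyUnramified_fst_of_graph` (★ p791848 §4 + ★ p787816)
  intro R _ _ _ A L hL hε S' _ p _ _ hat π _ hπ P hker _h1 _hrig hsock T' _ ℒ _hℒ Γ i _ hΓ
  haveI : IsLocallyNoetherian S' := LocallyOfFiniteType.isLocallyNoetherian p
  haveI : Etale π.left := hπ.2.1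
  haveI : Surjective π.left := hπ.2.2
  exact GraphUnramified.formallyUnramified_fst_of_graph (A.baseChange p) hat π (hasRank_pullback _ hL)
    (AbelianSchemeOver.cechPic_pullback_unitSection_baseChange_eq_one A p hL hε) hker P hsock T' ℒ Γ i hΓ

/-! ## §5 (N3′) — every infinitesimal neighbourhood of EVERY point of `T′` factors through the seesaw graph -/

/-- **stub (N3′) `stub_McN3`** — [MumfordAV1970] §13 (proof of the Theorem, the Artinian induction) over the residue field `κ(t)` of an
ARBITRARY point `t` of the affine finite-type `T′ → S′` (D3): every `Spec 𝒪_{T′,t}/𝔪^{n+1} → T′` factors through `Γ → T′`.  Tower: level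
`0` = a `κ(t)`-point of `Γ` over `t` ((H0): over `κ(t)^alg` every fibrewise-`Pic⁰` rigidified class on `A′_{κ̄}` is a fibre of `𝒫′`, B-p09
(g17) files 1–3 GREEN; descent `κ̄ → κ(t)` because `Γ_t ↪ Spec κ(t)` is a closed subscheme with a `κ̄`-point); frames by nilpotent
Nakayama (★ `ArtinianLevelFrames` port); the obstruction step by the Kodaira–Spencer map of `𝒫′`: injective ⇐ N3d′ (★
`ksLinear_injective_of_rigid`), surjective ⇐ `dim_κ Ȟ¹(A′_κ, 𝒪) = g` ((H1′), B-p07 (g20) CLOSED IN HOME) + `dim T_y Â′_s = g` (★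
`LevelTangentDimension` re-typed over `κ`).  The currency is the one ★ `Morphisms.isIso_of_isClosedImmersion_of_forall_factor` consumes.
Lead + two hands (8-file tower ≈ 1.5 k l.).  Why it might fail: only as typed; the mathematics is Mumford's §13.
[cite: MumfordAV1970, §13 (Thm. p. 125 and its proof, pp. 125–130)] [cite: Hartshorne1977, Ch. II, Prop. 5.9 (p. 116)] -/
theorem stub_McN3 : ∀ (R : Type) [CommRing R] [IsNoetherianRing R] [Algebra ℚ R] (A : AbelianSchemeOver (Spec (.of R)))
    (L : A.left.Modules) (hL : HasRank L 1)
    (_hε : CechPic.pullback A.unitSection (detClass (HasRank.isFiniteLocallyFree' hL)) = 1)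
    (_hΘ : ∀ ⦃Ω : Type⦄ [Field Ω] [IsAlgClosed Ω] (s : Spec (.of Ω) ⟶ Spec (.of R)),
      ∃ Θ : CartierDivisor (A.fibre s).toAbelianVariety.X.left, Θ.IsAmple ∧
        CechPic.pullback (X := (A.fibre s).toAbelianVariety.X.left) (pullback.fst A.X.hom s)
          (detClass (HasRank.isFiniteLocallyFree' hL)) = Θ.cechClass)
    {S' : Scheme.{0}} [IsAffine S'] (p : S' ⟶ Spec (.of R)) [IsFinite p] [Etale p] [Surjective p]
    (hat : AbelianSchemeOver S') (π : (A.baseChange p).X ⟶ hat.X) [IsMonHom π]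
    (_hπ : IsFinite π.left ∧ Etale π.left ∧ Surjective π.left)
    (P : ((A.baseChange p).prodLeft hat).Modules)
    (_hker : ∀ (T : Over S') (u : T ⟶ (A.baseChange p).X),
      u ≫ π = 1 ↔ (A.baseChange p).MemKOfL ((Scheme.Modules.pullback (pullback.fst A.X.hom p)).obj L) u)
    (_h1 : HasRank P 1)
    (_hrig : Nonempty ((Scheme.Modules.pullback ((A.baseChange p).unitSlice hat)).obj P ≅ SheafOfModules.unit _))
    (_hsock : Nonempty ((Scheme.Modules.pullback ((A.baseChange p).X ◁ π).left).obj P ≅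
      (A.baseChange p).mumfordBundle ((Scheme.Modules.pullback (pullback.fst A.X.hom p)).obj L)))
    (T' : Over S') [IsAffine T'.left] [LocallyOfFiniteType T'.hom]
    (ℒ : (A.baseChange p).RigidifiedLineBundle T'.hom) (_hℒ : ℒ.FibrewisePicZero)
    (Γ : Over S') (i : Γ ⟶ T' ⊗ hat.X) [IsClosedImmersion i.left],
    (∀ (S : Over S') (u : S ⟶ T' ⊗ hat.X), (∃ v : S ⟶ Γ, v ≫ i = u) ↔
      Nonempty ((Scheme.Modules.pullback ((A.baseChange p).baseChangeToProd hat S.hom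
          (u ≫ CartesianMonoidalCategory.snd T' hat.X).left (Over.w (u ≫ CartesianMonoidalCategory.snd T' hat.X)))).obj P ≅
        (Scheme.Modules.pullback ((A.baseChange p).X ◁ (u ≫ CartesianMonoidalCategory.fst T' hat.X)).left).obj ℒ.L)) →
    ∀ (t : T'.left) (n : ℕ),
      ∃ g : Spec (.of (↑(T'.left.presheaf.stalk t) ⧸
          IsLocalRing.maximalIdeal ↑(T'.left.presheaf.stalk t) ^ (n + 1))) ⟶ Γ.left,
        g ≫ (i ≫ CartesianMonoidalCategory.fst T' hat.X).left =
          Spec.map (CommRingCat.ofHom (Ideal.Quotient.mk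
            (IsLocalRing.maximalIdeal ↑(T'.left.presheaf.stalk t) ^ (n + 1)))) ≫ T'.left.fromSpecStalk t :=
  -- (N3′) CLOSED BY NAME (edition v2.2, F0P1c-p02 (g0), lead B-p02 (g17) route (a)) over ★ `Theorems/F3DualAbelianSchemeMcStubN3`
  -- (the Artinian tower of the great-grandchild line `F3DualAbelianSchemeMcN3`, all six letters ★): statement ≡ `stub_McN3_holds`.
  stub_McN3_holds

/-! ## §6 SOCKET (W1) — a generic ★-brick in flight (B-p03 (g20)); deleted by an edition when it lands -/

/-- **socket (W1) `socket_McW1`** — [EGAIV4, Cor. 17.2.6 / 18.12.6] / [StacksProject, Tag 04XV]: a morphism locally of finite type,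
FORMALLY UNRAMIFIED, PROPER and INJECTIVE ON `Spec Ω`-POINTS for every algebraically closed `Ω` is a CLOSED IMMERSION (unramified +
universally injective ⇒ monomorphism: the diagonal is an open immersion and surjective; proper mono ⇒ closed immersion, Mathlib
`IsClosedImmersion.iff_isProper_and_mono`).  Generic `Morphisms/` brick W1 of SPINE v0 (B-p03 (g20), GO 20:03:53Z) replacing ★
`isClosedImmersion_left_of_isProper_of_formallyUnramified_of_injective_complexPoints` (Jacobson/ℂ-points) per D2.  NOT a stub of the
line: the pen files it straight to Literature; this socket is removed by an edition then. [cite: EGAIV4, Cor. 17.2.6 and Cor. 18.12.6]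
[cite: StacksProject, Tag 04XV] -/
theorem socket_McW1 : ∀ {X Y : Scheme.{0}} (f : X ⟶ Y) [FormallyUnramified f] [IsProper f],
    (∀ (Ω : Type) [Field Ω] [IsAlgClosed Ω] (x₁ x₂ : Spec (.of Ω) ⟶ X), x₁ ≫ f = x₂ ≫ f → x₁ = x₂) →
    IsClosedImmersion f := by
  -- (W1) DISCHARGED BY NAME (v2.1): ★ p792179 `Morphisms/ClosedImmersionOfProperUnramifiedInjective` (B-p03 (g20))
  exact fun f _ _ hinj => Literature.AlgebraicGeometry.Morphisms.isClosedImmersion_of_forall_injective_geometricPoints f hinj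

/-! ## §7 (N0′) — all `T` from affine finite-type `T` (Zariski locality + spreading out) -/

/-- **stub (N0′) `stub_McN0`** — «AFFINE FINITE TYPE ⇒ ALL `T → S′`»: the universal property over every `T` follows from the universal
property over affine `T` of finite type over `S′`, by Zariski locality of the `∃!` (★ `PoincareUniversalLocality.existsUnique_classify_of_affine`
— generic `A B : AbelianSchemeOver S`; ★ `RigidifiedGluing.rigidifiedGluing_of_stein` with ★ `AbelianSchemeSteinOfNoetherian.baseChange_app_bijective`)
and spreading out of `(T, ℒ)` over an affine `T` to finite type (`Â′ → S′` locally of finite presentation; ★ `Limits/` capital as in the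
ℂ-template ★ `PoincareUniversal/AffineFiniteTypeToAll`).  B-p16 (g18) census 19:56:56Z; hand B-p16 after N2b′ or a free hand.  Size M.
Why it might fail: only as typed. [cite: MumfordAV1970, §13 (Thm. p. 125)] [cite: GortzWedhorn2023, (27.41) eq. (27.41.1) and Def. 27.216 (pp. 688–689)] -/
theorem stub_McN0 : ∀ (R : Type) [CommRing R] [IsNoetherianRing R] [Algebra ℚ R] (A : AbelianSchemeOver (Spec (.of R)))
    (L : A.left.Modules) (hL : HasRank L 1)
    (_hε : CechPic.pullback A.unitSection (detClass (HasRank.isFiniteLocallyFree' hL)) = 1)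
    (_hΘ : ∀ ⦃Ω : Type⦄ [Field Ω] [IsAlgClosed Ω] (s : Spec (.of Ω) ⟶ Spec (.of R)),
      ∃ Θ : CartierDivisor (A.fibre s).toAbelianVariety.X.left, Θ.IsAmple ∧
        CechPic.pullback (X := (A.fibre s).toAbelianVariety.X.left) (pullback.fst A.X.hom s)
          (detClass (HasRank.isFiniteLocallyFree' hL)) = Θ.cechClass)
    {S' : Scheme.{0}} [IsAffine S'] (p : S' ⟶ Spec (.of R)) [IsFinite p] [Etale p] [Surjective p]
    (hat : AbelianSchemeOver S') (π : (A.baseChange p).X ⟶ hat.X) [IsMonHom π]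
    (_hπ : IsFinite π.left ∧ Etale π.left ∧ Surjective π.left)
    (P : ((A.baseChange p).prodLeft hat).Modules)
    (_hker : ∀ (T : Over S') (u : T ⟶ (A.baseChange p).X),
      u ≫ π = 1 ↔ (A.baseChange p).MemKOfL ((Scheme.Modules.pullback (pullback.fst A.X.hom p)).obj L) u)
    (_h1 : HasRank P 1)
    (_hrig : Nonempty ((Scheme.Modules.pullback ((A.baseChange p).unitSlice hat)).obj P ≅ SheafOfModules.unit _))
    (_hsock : Nonempty ((Scheme.Modules.pullback ((A.baseChange p).X ◁ π).left).obj P ≅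
      (A.baseChange p).mumfordBundle ((Scheme.Modules.pullback (pullback.fst A.X.hom p)).obj L))),
    (∀ {T : Scheme.{0}} (f : T ⟶ S') [IsAffine T] [LocallyOfFiniteType f]
      (ℒ : (A.baseChange p).RigidifiedLineBundle f), ℒ.FibrewisePicZero →
      ∃! g : {g : T ⟶ hat.X.left // g ≫ hat.X.hom = f},
        Nonempty ((Scheme.Modules.pullback ((A.baseChange p).baseChangeToProd hat f g.1 g.2)).obj P ≅ ℒ.L)) →
    ∀ {T : Scheme.{0}} (f : T ⟶ S') (ℒ : (A.baseChange p).RigidifiedLineBundle f), ℒ.FibrewisePicZero →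
      ∃! g : {g : T ⟶ hat.X.left // g ≫ hat.X.hom = f},
        Nonempty ((Scheme.Modules.pullback ((A.baseChange p).baseChangeToProd hat f g.1 g.2)).obj P ≅ ℒ.L) :=
  -- (N0′) DISCHARGED BY NAME (v2.1): ★ p793055 `Theorems/F3DualAbelianSchemeMcStubN0` (F0P1c-p06 (g0), six files p792323…p793055)
  stub_McN0_holds

/-! ## §8 THE COMPOSITION over an affine finite-type `T → S′` (★ `Residual.residual_affineFiniteType_of_M13` ported) -/

section Composition

variable (R : Type) [CommRing R] [IsNoetherianRing R] [Algebra ℚ R] (A : AbelianSchemeOver (Spec (.of R)))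
    (L : A.left.Modules) (hL : HasRank L 1)
    (hε : CechPic.pullback A.unitSection (detClass (HasRank.isFiniteLocallyFree' hL)) = 1)
    (hΘ : ∀ ⦃Ω : Type⦄ [Field Ω] [IsAlgClosed Ω] (s : Spec (.of Ω) ⟶ Spec (.of R)),
      ∃ Θ : CartierDivisor (A.fibre s).toAbelianVariety.X.left, Θ.IsAmple ∧
        CechPic.pullback (X := (A.fibre s).toAbelianVariety.X.left) (pullback.fst A.X.hom s)
          (detClass (HasRank.isFiniteLocallyFree' hL)) = Θ.cechClass)
    {S' : Scheme.{0}} [IsAffine S'] (p : S' ⟶ Spec (.of R)) [IsFinite p] [Etale p] [Surjective p]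
    (hat : AbelianSchemeOver S') (π : (A.baseChange p).X ⟶ hat.X) [IsMonHom π]
    (hπ : IsFinite π.left ∧ Etale π.left ∧ Surjective π.left)
    (P : ((A.baseChange p).prodLeft hat).Modules)
    (hker : ∀ (T : Over S') (u : T ⟶ (A.baseChange p).X),
      u ≫ π = 1 ↔ (A.baseChange p).MemKOfL ((Scheme.Modules.pullback (pullback.fst A.X.hom p)).obj L) u)
    (h1 : HasRank P 1)
    (hrig : Nonempty ((Scheme.Modules.pullback ((A.baseChange p).unitSlice hat)).obj P ≅ SheafOfModules.unit _))
    (hsock : Nonempty ((Scheme.Modules.pullback ((A.baseChange p).X ◁ π).left).obj P ≅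
      (A.baseChange p).mumfordBundle ((Scheme.Modules.pullback (pullback.fst A.X.hom p)).obj L)))

include hε hΘ hπ hker h1 hrig hsock in
set_option backward.isDefEq.respectTransparency false in
/-- **ROAD M13 RELATIVE TO `S′`, OVER AN AFFINE FINITE-TYPE BASE** ([MumfordAV1970] §13 (proof of the Theorem p. 125) in the «mono, not
étale» form; port of ★ `Residual.residual_affineFiniteType_of_M13`): the seesaw graph `Γ ↪ T × Â′ → T` (N1′ + N2a′) is proper (`Â′`
proper) and formally unramified (N3d′), injective on geometric points (N2b′) hence a CLOSED IMMERSION (W1), through which every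
infinitesimal neighbourhood of every point factors (N3′), hence an ISOMORPHISM (★ `Morphisms.isIso_of_isClosedImmersion_of_forall_factor`,
all points); its inverse followed by `pr_{Â′}` is the unique classifying map. [cite: MumfordAV1970, §13 (Thm. p. 125 and its proof)]
[cite: Hartshorne1977, Ch. II, Prop. 5.9 (p. 116)] -/
theorem stub_F3Mc_affineFiniteType_of (T' : Over S') [IsAffine T'.left] [LocallyOfFiniteType T'.hom]
    (ℒ : (A.baseChange p).RigidifiedLineBundle T'.hom) (hℒ : ℒ.FibrewisePicZero) :
    ∃! g : {g : T'.left ⟶ hat.X.left // g ≫ hat.X.hom = T'.hom},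
      Nonempty ((Scheme.Modules.pullback ((A.baseChange p).baseChangeToProd hat T'.hom g.1 g.2)).obj P ≅ ℒ.L) := by
  -- `Â′` and the instances
  haveI := hat.isProper
  haveI := hat.isSmooth
  haveI : IsLocallyNoetherian S' := LocallyOfFiniteType.isLocallyNoetherian p
  haveI : IsLocallyNoetherian T'.left := LocallyOfFiniteType.isLocallyNoetherian T'.hom
  -- the functor of points we represent = the graph condition, SPELLED OUT (D1); an opaque local name with its unfolding
  obtain ⟨GC, hGC⟩ : ∃ GC : ∀ (S : Over S') (_ : S ⟶ T' ⊗ hat.X), Prop, ∀ (S : Over S') (u : S ⟶ T' ⊗ hat.X), GC S u ↔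
      Nonempty ((Scheme.Modules.pullback ((A.baseChange p).baseChangeToProd hat S.hom
          (u ≫ CartesianMonoidalCategory.snd T' hat.X).left (Over.w (u ≫ CartesianMonoidalCategory.snd T' hat.X)))).obj P ≅
        (Scheme.Modules.pullback ((A.baseChange p).X ◁ (u ≫ CartesianMonoidalCategory.fst T' hat.X)).left).obj ℒ.L) :=
    ⟨_, fun _ _ => Iff.rfl⟩
  -- (N1′ + N2a′) the seesaw graph `Γ ↪ T × Â′` with `Γ(S) = {u ; GC u}`
  haveI : LocallyOfFiniteType (CartesianMonoidalCategory.fst T' hat.X).left :=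
    inferInstanceAs (LocallyOfFiniteType (pullback.fst T'.hom hat.X.hom))
  haveI : LocallyOfFiniteType (T' ⊗ hat.X).hom := by
    rw [← Over.w (CartesianMonoidalCategory.fst T' hat.X)]
    infer_instance
  have h𝓕1 : HasRank (tensorObj
      ((Scheme.Modules.pullback ((A.baseChange p).X ◁ CartesianMonoidalCategory.fst T' hat.X).left).obj ℒ.L)
      (Literature.AlgebraicGeometry.Modules.dual
        ((Scheme.Modules.pullback ((A.baseChange p).X ◁ CartesianMonoidalCategory.snd T' hat.X).left).obj P))) 1 :=
    hasRank_tensorObj_one (hasRank_pullback _ ℒ.hasRank_one) (hasRank_dual (hasRank_pullback _ h1))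
  obtain ⟨Γ, i, hi, hZ⟩ := stub_McN1 R A p (T' ⊗ hat.X) _ h𝓕1
  haveI := hi
  have hΓ' : ∀ (S : Over S') (u : S ⟶ T' ⊗ hat.X), (∃ v : S ⟶ Γ, v ≫ i = u) ↔
      Nonempty ((Scheme.Modules.pullback ((A.baseChange p).baseChangeToProd hat S.hom
          (u ≫ CartesianMonoidalCategory.snd T' hat.X).left (Over.w (u ≫ CartesianMonoidalCategory.snd T' hat.X)))).obj P ≅
        (Scheme.Modules.pullback ((A.baseChange p).X ◁ (u ≫ CartesianMonoidalCategory.fst T' hat.X)).left).obj ℒ.L) :=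
    fun S u => (hZ S u).trans (stub_McN2a R A p hat P h1 hrig T' ℒ S u)
  have hΓ : ∀ (S : Over S') (u : S ⟶ T' ⊗ hat.X), (∃ v : S ⟶ Γ, v ≫ i = u) ↔ GC S u := fun S u =>
    (hΓ' S u).trans (hGC S u).symm
  -- instances along `q := i ≫ pr_T : Γ → T`
  haveI : IsProper (CartesianMonoidalCategory.fst T' hat.X).left :=
    inferInstanceAs (IsProper (pullback.fst T'.hom hat.X.hom))
  haveI : IsProper (i ≫ CartesianMonoidalCategory.fst T' hat.X).left := by
    change IsProper (i.left ≫ (CartesianMonoidalCategory.fst T' hat.X).left)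
    infer_instance
  haveI : LocallyOfFiniteType Γ.hom := by
    rw [← Over.w (i ≫ CartesianMonoidalCategory.fst T' hat.X)]
    infer_instance
  haveI : Mono i := (Over.forget _).mono_of_mono_map (inferInstanceAs (Mono i.left))
  -- (N3d′) formally unramified
  haveI : FormallyUnramified (i ≫ CartesianMonoidalCategory.fst T' hat.X).left :=
    stub_McN3d R A L hL hε p hat π hπ P hker h1 hrig hsock T' ℒ hℒ Γ i hΓ'
  -- (N2b′) injective on geometric points, hence (W1) a closed immersion
  have hinj : ∀ (Ω : Type) [Field Ω] [IsAlgClosed Ω] (x₁ x₂ : Spec (.of Ω) ⟶ Γ.left),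
      x₁ ≫ (i ≫ CartesianMonoidalCategory.fst T' hat.X).left = x₂ ≫ (i ≫ CartesianMonoidalCategory.fst T' hat.X).left →
        x₁ = x₂ := by
    intro Ω _ _ x₁ x₂ h12
    obtain ⟨s, hs₁⟩ : ∃ s : Spec (.of Ω) ⟶ S', x₁ ≫ Γ.hom = s := ⟨_, rfl⟩
    have hs₂ : x₂ ≫ Γ.hom = s := by
      rw [← hs₁, ← Over.w (i ≫ CartesianMonoidalCategory.fst T' hat.X), ← Category.assoc, ← Category.assoc, h12]
    obtain ⟨o₁, ho₁⟩ : ∃ o₁ : Over.mk s ⟶ Γ, o₁.left = x₁ := ⟨Over.homMk x₁ hs₁, rfl⟩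
    obtain ⟨o₂, ho₂⟩ : ∃ o₂ : Over.mk s ⟶ Γ, o₂.left = x₂ := ⟨Over.homMk x₂ hs₂, rfl⟩
    have hx : o₁ ≫ i ≫ CartesianMonoidalCategory.fst T' hat.X = o₂ ≫ i ≫ CartesianMonoidalCategory.fst T' hat.X :=
      Over.OverMorphism.ext (by simp only [Over.comp_left, ho₁, ho₂] at h12 ⊢; exact h12)
    have g₁ := (hΓ' _ _).mp ⟨o₁, rfl⟩
    have g₂ := (hΓ' _ _).mp ⟨o₂, rfl⟩
    have hyy := stub_McN2b R A L hL p hat π hπ P hker h1 hsock T' ℒ hℒ s (o₁ ≫ i) (o₂ ≫ i)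
      (by simpa only [Category.assoc] using hx) g₁ g₂
    have hoi : o₁ ≫ i = o₂ ≫ i := by
      apply CartesianMonoidalCategory.hom_ext
      · simpa only [Category.assoc] using hx
      · simpa only [Category.assoc] using hyy
    have ho : o₁ = o₂ := (cancel_mono i).1 hoi
    rw [← ho₁, ← ho₂, ho]
  haveI : IsClosedImmersion (i ≫ CartesianMonoidalCategory.fst T' hat.X).left := socket_McW1 _ hinj
  -- (N3′) every infinitesimal neighbourhood factors, hence an isomorphism
  haveI : IsIso (i ≫ CartesianMonoidalCategory.fst T' hat.X).left :=
    Literature.AlgebraicGeometry.Morphisms.isIso_of_isClosedImmersion_of_forall_factor _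
      (stub_McN3 R A L hL hε hΘ p hat π hπ P hker h1 hrig hsock T' ℒ hℒ Γ i hΓ')
  haveI : IsIso ((Over.forget S').map (i ≫ CartesianMonoidalCategory.fst T' hat.X)) := by
    change IsIso (i ≫ CartesianMonoidalCategory.fst T' hat.X).left
    infer_instance
  haveI : IsIso (i ≫ CartesianMonoidalCategory.fst T' hat.X) :=
    isIso_of_reflects_iso (i ≫ CartesianMonoidalCategory.fst T' hat.X) (Over.forget S')
  -- the section and the conclusion
  obtain ⟨σ, hσ⟩ : ∃ σ : T' ⟶ hat.X,
      σ = inv (i ≫ CartesianMonoidalCategory.fst T' hat.X) ≫ i ≫ CartesianMonoidalCategory.snd _ _ := ⟨_, rfl⟩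
  have hsec : inv (i ≫ CartesianMonoidalCategory.fst T' hat.X) ≫ i = CartesianMonoidalCategory.lift (𝟙 _) σ := by
    apply CartesianMonoidalCategory.hom_ext
    · rw [CartesianMonoidalCategory.lift_fst, Category.assoc, IsIso.inv_hom_id]
    · rw [CartesianMonoidalCategory.lift_snd, Category.assoc, hσ]
  -- the graph condition at a section `(1, s)` IS the universal-property clause for `g = s`
  have hlift : ∀ s : T' ⟶ hat.X, GC _ (CartesianMonoidalCategory.lift (𝟙 _) s) ↔
      Nonempty ((Scheme.Modules.pullback ((A.baseChange p).baseChangeToProd hat T'.hom s.left (Over.w s))).obj P ≅ ℒ.L) := by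
    intro s
    rw [hGC]
    have hφ : (A.baseChange p).baseChangeToProd hat T'.hom
          (CartesianMonoidalCategory.lift (𝟙 _) s ≫ CartesianMonoidalCategory.snd _ _).left
          (Over.w (CartesianMonoidalCategory.lift (𝟙 _) s ≫ CartesianMonoidalCategory.snd _ _)) =
        (A.baseChange p).baseChangeToProd hat T'.hom s.left (Over.w s) :=
      AbelianSchemeOver.baseChangeToProd_congr _ _ _ (by rw [CartesianMonoidalCategory.lift_snd]) _ _
    have e₁ := congrArg (fun φ => (Scheme.Modules.pullback φ).obj P) hφ
    have hw : ((A.baseChange p).X ◁ (CartesianMonoidalCategory.lift (𝟙 T') s ≫ CartesianMonoidalCategory.fst _ _)).left =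
        𝟙 _ := by
      rw [CartesianMonoidalCategory.lift_fst, MonoidalCategory.whiskerLeft_id, Over.id_left]
    have e₂ : (Scheme.Modules.pullback ((A.baseChange p).X ◁
          (CartesianMonoidalCategory.lift (𝟙 T') s ≫ CartesianMonoidalCategory.fst _ _)).left).obj ℒ.L ≅ ℒ.L :=
      eqToIso (congrArg (fun φ => (Scheme.Modules.pullback φ).obj ℒ.L) hw) ≪≫ (Scheme.Modules.pullbackId _).app ℒ.L
    exact ⟨fun ⟨φ⟩ => ⟨(eqToIso e₁).symm ≪≫ φ ≪≫ e₂⟩, fun ⟨ψ⟩ => ⟨eqToIso e₁ ≪≫ ψ ≪≫ e₂.symm⟩⟩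
  have hcσ : GC _ (CartesianMonoidalCategory.lift (𝟙 _) σ) := hsec ▸ (hΓ _ _).mp ⟨_, rfl⟩
  refine ⟨⟨σ.left, Over.w σ⟩, (hlift σ).mp hcσ, ?_⟩
  rintro ⟨g', hg'⟩ hψ
  obtain ⟨s', hs'⟩ : ∃ s' : T' ⟶ hat.X, s'.left = g' := ⟨Over.homMk g' hg', rfl⟩
  subst hs'
  have hc' : GC _ (CartesianMonoidalCategory.lift (𝟙 _) s') := (hlift s').mpr hψ
  obtain ⟨v, hv⟩ := (hΓ _ _).mpr hc'
  have hvp : v ≫ (i ≫ CartesianMonoidalCategory.fst T' hat.X) = 𝟙 _ := by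
    rw [← Category.assoc, hv, CartesianMonoidalCategory.lift_fst]
  have hv' : v = inv (i ≫ CartesianMonoidalCategory.fst T' hat.X) := by
    rw [← cancel_mono (i ≫ CartesianMonoidalCategory.fst T' hat.X), hvp, IsIso.inv_hom_id]
  have hs : s' = σ := by
    rw [← CartesianMonoidalCategory.lift_snd (𝟙 _) s', ← hv, hv', Category.assoc, hσ]
  exact Subtype.ext (congrArg (fun s => s.left) hs)

end Composition

/-! ## §9 THE HEAD — the child-line letter (Mc) `stub_F3Mc` VERBATIM, PROVED from §8 + N0′ -/

/-- **HEAD `stub_F3Mc_holds`** = letter (Mc) of `Cruxes/HDel/Lines/F3DualAbelianSchemeM.lean` ed. 4 (8047f009), statement VERBATIM,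
PROVED: N0′ reduces to an affine finite-type base, settled by §8.  [cite: MumfordAV1970, §13 Theorem (p. 125)]
[cite: MumfordFogartyKirwan1994, Ch. 6 §2 (p. 121)] [cite: MilneAV2008, I §8 pp. 36–37] -/
theorem stub_F3Mc_holds : ∀ (R : Type) [CommRing R] [IsNoetherianRing R] [Algebra ℚ R] (A : AbelianSchemeOver (Spec (.of R)))
    (L : A.left.Modules) (hL : HasRank L 1)
    (_hε : CechPic.pullback A.unitSection (detClass (HasRank.isFiniteLocallyFree' hL)) = 1)
    (_hΘ : ∀ ⦃Ω : Type⦄ [Field Ω] [IsAlgClosed Ω] (s : Spec (.of Ω) ⟶ Spec (.of R)),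
      ∃ Θ : CartierDivisor (A.fibre s).toAbelianVariety.X.left, Θ.IsAmple ∧
        CechPic.pullback (X := (A.fibre s).toAbelianVariety.X.left) (pullback.fst A.X.hom s)
          (detClass (HasRank.isFiniteLocallyFree' hL)) = Θ.cechClass)
    {S' : Scheme.{0}} [IsAffine S'] (p : S' ⟶ Spec (.of R)) [IsFinite p] [Etale p] [Surjective p]
    (hat : AbelianSchemeOver S') (π : (A.baseChange p).X ⟶ hat.X) [IsMonHom π]
    (_hπ : IsFinite π.left ∧ Etale π.left ∧ Surjective π.left)
    (P : ((A.baseChange p).prodLeft hat).Modules)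
    (_hker : ∀ (T : Over S') (u : T ⟶ (A.baseChange p).X),
      u ≫ π = 1 ↔ (A.baseChange p).MemKOfL ((Scheme.Modules.pullback (pullback.fst A.X.hom p)).obj L) u)
    (_h1 : HasRank P 1)
    (_hrig : Nonempty ((Scheme.Modules.pullback ((A.baseChange p).unitSlice hat)).obj P ≅ SheafOfModules.unit _))
    (_hsock : Nonempty ((Scheme.Modules.pullback ((A.baseChange p).X ◁ π).left).obj P ≅
      (A.baseChange p).mumfordBundle ((Scheme.Modules.pullback (pullback.fst A.X.hom p)).obj L))),
    ∀ {T : Scheme.{0}} (f : T ⟶ S') (ℒ : (A.baseChange p).RigidifiedLineBundle f), ℒ.FibrewisePicZero →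
      ∃! g : {g : T ⟶ hat.X.left // g ≫ hat.X.hom = f},
        Nonempty ((Scheme.Modules.pullback ((A.baseChange p).baseChangeToProd hat f g.1 g.2)).obj P ≅ ℒ.L) := by
  intro R _ _ _ A L hL hε hΘ S' _ p _ _ _ hat π _ hπ P hker h1 hrig hsock
  exact stub_McN0 R A L hL hε hΘ p hat π hπ P hker h1 hrig hsock
    (fun f hT hfT ℒ hℒ => by
      haveI : IsAffine (Over.mk f).left := hT
      haveI : LocallyOfFiniteType (Over.mk f).hom := hfT
      exact stub_F3Mc_affineFiniteType_of R A L hL hε hΘ p hat π hπ P hker h1 hrig hsock (Over.mk f) ℒ hℒ)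

end Summit.HodgeConjecture.CorCM.Cruxes.HypDel.F3DualAbelianSchemeMc

end
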